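import Summits.HubbardSuperconductivity.HubbardSuperconductivity.Theses.BalabanIR
import Summits.HubbardSuperconductivity.HubbardSuperconductivity.Theorems.BalabanIRBirEveryGroundStateSocketResidues
import Literature.MathematicalPhysics.QuantumLattice.PairFieldMomentum

/-!
# Sketch — crux-ideate stmt-HubbardSuperconductivity-2083 (`BalabanIR.BirEveryGroundState`), ideator 4, round 2

Card `fejer-split-chord`.  First lemmas, stated (and the glue ones proved) over existing
declarations.

* `modeOp L m = L⁻⁴ Δ_d(m)ᴴ Δ_d(m)` (momentum-resolved d-wave pair intensity, `pairFieldAt`);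
  `localOrderOp L w = Σ_m w m • modeOp L m`, `twistOp L w = Σ_{m ≠ 0} w m • modeOp L m`;
  `localOrderOp_sub_twistOp`: for any weight with `w 0 = 1`,
  `localOrderOp L w - twistOp L w = L⁻⁴ Δ_dᴴ Δ_d` (the FEJÉR SPLIT of the crux's order operator:
  global order = local order − finite-momentum pair weight; with the Fejér weight `fejerWeight L R`
  the first operator is a range-`R` pair–pair correlation and the second lives on `|q| ≲ 2π/R`).
* `chord_of_local_of_stiffness` (PROVED, pure finite-dimensional): if the LOCAL-ORDER penalty
  gap `minE(H + κ₁A) ≥ minE H + κ₁a` and the STIFFNESS bound `minE(H − κ₂B) ≥ minE H − κ₂b` hold on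
  a sector `K`, then the κ-chord `minE(H + η(A − B)) ≥ minE H + η(a − b)` holds with
  `η = κ₁κ₂/(κ₁+κ₂)` (convex combination of the two inequalities).
* `LocalPairCoercivityAt`, `PairStiffnessAt` (the two stubs, Hubbard shell) and `KappaChordAt`
  (verbatim the hypothesis shape of the landed closer
  `Theorems.birEveryGroundState_structural_of_kappaChord`), with
  `kappaChordAt_of_local_of_stiffness` (PROVED from the two lemmas above).
-/

set_option linter.dupNamespace false

noncomputable section

namespace Summit.HubbardSuperconductivity.HubbardSuperconductivity.Cruxes.BirEveryGroundState.SketchIdeator4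

open Matrix Finset Literature.Probability.LatticeModels Literature.MathematicalPhysics.QuantumLattice
open scoped ComplexOrder

/-! ### Abstract glue: the chord is a convex combination of a local-order gap and a stiffness bound -/

section Abstract

variable {n : Type*} [Fintype n]

private theorem re_rayleigh_add_smul (H M : Matrix n n ℂ) (c : ℝ) (φ : n → ℂ) :
    (star φ ⬝ᵥ (H + (c : ℂ) • M) *ᵥ φ).re =
      (star φ ⬝ᵥ H *ᵥ φ).re + c * (star φ ⬝ᵥ M *ᵥ φ).re := by
  rw [add_mulVec, dotProduct_add, Complex.add_re, smul_mulVec, dotProduct_smul, smul_eq_mul,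
    Complex.re_ofReal_mul]

private theorem re_rayleigh_sub_smul (H M : Matrix n n ℂ) (c : ℝ) (φ : n → ℂ) :
    (star φ ⬝ᵥ (H - (c : ℂ) • M) *ᵥ φ).re =
      (star φ ⬝ᵥ H *ᵥ φ).re - c * (star φ ⬝ᵥ M *ᵥ φ).re := by
  rw [sub_mulVec, dotProduct_sub, Complex.sub_re, smul_mulVec, dotProduct_smul, smul_eq_mul,
    Complex.re_ofReal_mul]

private theorem re_rayleigh_sub (A B : Matrix n n ℂ) (φ : n → ℂ) :
    (star φ ⬝ᵥ (A - B) *ᵥ φ).re = (star φ ⬝ᵥ A *ᵥ φ).re - (star φ ⬝ᵥ B *ᵥ φ).re := by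
  rw [sub_mulVec, dotProduct_sub, Complex.sub_re]

private theorem real_glue {E h α β a b κ₁ κ₂ : ℝ} (hκ₁ : 0 < κ₁) (hκ₂ : 0 < κ₂)
    (h1 : E + κ₁ * a ≤ h + κ₁ * α) (h2 : E - κ₂ * b ≤ h - κ₂ * β) :
    E + κ₁ * κ₂ / (κ₁ + κ₂) * (a - b) ≤ h + κ₁ * κ₂ / (κ₁ + κ₂) * (α - β) := by
  have hs : 0 < κ₁ + κ₂ := add_pos hκ₁ hκ₂
  rw [← sub_nonneg]
  have key : (h + κ₁ * κ₂ / (κ₁ + κ₂) * (α - β)) - (E + κ₁ * κ₂ / (κ₁ + κ₂) * (a - b)) =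
      ((κ₂ * (h + κ₁ * α) - κ₂ * (E + κ₁ * a)) + (κ₁ * (h - κ₂ * β) - κ₁ * (E - κ₂ * b))) /
        (κ₁ + κ₂) := by
    field_simp
    ring
  rw [key]
  apply div_nonneg _ hs.le
  nlinarith [mul_le_mul_of_nonneg_left h1 hκ₂.le, mul_le_mul_of_nonneg_left h2 hκ₁.le]

/-- **The κ-chord as a convex combination** (card `fejer-split-chord`, glue; PROVED).
`H, A, B` arbitrary square matrices, `K` a subspace, `κ₁, κ₂ > 0`.  If
(local-order penalty gap) `minE_K H + κ₁ a ≤ minE_K (H + κ₁ A)` and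
(stiffness bound)        `minE_K H − κ₂ b ≤ minE_K (H − κ₂ B)`,
then with `η := κ₁κ₂/(κ₁+κ₂)`: `minE_K H + η (a − b) ≤ minE_K (H + η (A − B))`.
Proof: `H + η(A − B) = t(H + κ₁A) + (1−t)(H − κ₂B)` with `t = κ₂/(κ₁+κ₂)`, and an infimum of a
convex combination dominates the convex combination of the infima (no nonemptiness of `K` needed:
if `K` has no unit vector all three `minEnergyOn`s are the junk value `0` and the hypotheses force
`a ≤ 0 ≤ b`). [folklore] -/
theorem chord_of_local_of_stiffness (H A B : Matrix n n ℂ) (K : Submodule ℂ (n → ℂ))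
    {κ₁ κ₂ a b : ℝ} (hκ₁ : 0 < κ₁) (hκ₂ : 0 < κ₂)
    (hloc : H.minEnergyOn K + κ₁ * a ≤ (H + (κ₁ : ℂ) • A).minEnergyOn K)
    (hstiff : H.minEnergyOn K - κ₂ * b ≤ (H - (κ₂ : ℂ) • B).minEnergyOn K) :
    H.minEnergyOn K + κ₁ * κ₂ / (κ₁ + κ₂) * (a - b) ≤
      (H + ((κ₁ * κ₂ / (κ₁ + κ₂) : ℝ) : ℂ) • (A - B)).minEnergyOn K := by
  by_cases hne : ∃ ψ ∈ K, star ψ ⬝ᵥ ψ = 1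
  · obtain ⟨ψ₀, hψ₀K, hψ₀⟩ := hne
    change _ ≤ sInf _
    refine le_csInf ⟨_, ψ₀, hψ₀K, hψ₀, rfl⟩ ?_
    rintro e ⟨φ, hφK, hφ, rfl⟩
    have h1 := hloc.trans (Theorems.minEnergyOn_le_re_rayleigh (H + (κ₁ : ℂ) • A) K hφK hφ)
    have h2 := hstiff.trans (Theorems.minEnergyOn_le_re_rayleigh (H - (κ₂ : ℂ) • B) K hφK hφ)
    rw [re_rayleigh_add_smul] at h1
    rw [re_rayleigh_sub_smul] at h2
    rw [re_rayleigh_add_smul, re_rayleigh_sub]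
    exact real_glue hκ₁ hκ₂ h1 h2
  · have hempty : ∀ M : Matrix n n ℂ, M.minEnergyOn K = 0 := by
      intro M
      rw [Matrix.minEnergyOn]
      convert Real.sInf_empty
      ext E
      simp only [Set.mem_setOf_eq, Set.mem_empty_iff_false, iff_false]
      rintro ⟨ψ, hψK, hψ, -⟩
      exact hne ⟨ψ, hψK, hψ⟩
    rw [hempty, hempty] at hloc hstiff
    rw [hempty, hempty]
    have hs : 0 < κ₁ + κ₂ := add_pos hκ₁ hκ₂
    have ha : a ≤ 0 := by nlinarith
    have hb : 0 ≤ b := by nlinarith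
    have : κ₁ * κ₂ / (κ₁ + κ₂) * (a - b) ≤ 0 :=
      mul_nonpos_of_nonneg_of_nonpos (by positivity) (by linarith)
    linarith

/-- **Robust brightness ⇔ chord, the corner duality** (card `fejer-split-chord`; the `⇒`
direction, elementary; cf. `Theorems.le_minEnergyOn_add_smul_sub_of_depletionCost` for the same
lemma in route KacWindowPenalty's vocabulary and `Theorems.chord_div_le_re_expect` for `⇐`).
If `Y ≥ 0` on the unit vectors of `K` and every unit `φ ∈ K` within `κ` of the sector ground energy
has `Re ⟨φ, Y φ⟩ ≥ a`, then `minE_K (H + ηY) ≥ minE_K H + min κ (ηa)` for every `η > 0`.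
Stated as a `Prop` (not needed for the line; it shows the chord is the MINIMAL robust form of
"every ground state is bright"). [folklore] -/
def CornerDuality : Prop :=
  ∀ (n : Type) [Fintype n] (H Y : Matrix n n ℂ) (K : Submodule ℂ (n → ℂ)) (κ a η : ℝ),
    0 < η → (∃ ψ ∈ K, star ψ ⬝ᵥ ψ = 1) →
    (∀ φ ∈ K, star φ ⬝ᵥ φ = 1 → 0 ≤ (star φ ⬝ᵥ Y *ᵥ φ).re) →
    (∀ φ ∈ K, star φ ⬝ᵥ φ = 1 → (star φ ⬝ᵥ H *ᵥ φ).re ≤ H.minEnergyOn K + κ →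
      a ≤ (star φ ⬝ᵥ Y *ᵥ φ).re) →
    H.minEnergyOn K + min κ (η * a) ≤ (H + (η : ℂ) • Y).minEnergyOn K

end Abstract

/-! ### The Fejér split of the d-wave order operator on the fermionic torus -/

section Torus

variable (L : ℕ) [NeZero L]

/-- The normalised intensity of the d-wave pair mode at momentum label `m`:
`modeOp L m = L⁻⁴ Δ_d(m)ᴴ Δ_d(m)` (`Δ_d(m) = pairFieldAt dWaveFormFactor L m`; its expectation is
`L⁻² ·` the pair structure factor `pairStructureFactor`). [folklore] -/
def modeOp (m : TorusSite 2 L) :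
    Matrix (Finset (Orb (FermionTorus 2 L))) (Finset (Orb (FermionTorus 2 L))) ℂ :=
  ((1 : ℂ) / (L : ℂ) ^ 4) • ((pairFieldAt dWaveFormFactor L m)ᴴ * pairFieldAt dWaveFormFactor L m)

/-- Weighted LOCAL ORDER operator `Σ_m w(m) • modeOp L m` (all momenta).  For the Fejér weight
`w = fejerWeight L R` this is the translation average of the range-`R` smoothed pair–pair
correlation `Σ_r F_R(r) P_xᴴ P_{x+r}` (Bochner/Plancherel on `(ℤ/L)²`). [folklore] -/
def localOrderOp (w : TorusSite 2 L → ℝ) :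
    Matrix (Finset (Orb (FermionTorus 2 L))) (Finset (Orb (FermionTorus 2 L))) ℂ :=
  ∑ m, ((w m : ℝ) : ℂ) • modeOp L m

/-- Weighted FINITE-MOMENTUM ("twist") operator `Σ_{m ≠ 0} w(m) • modeOp L m`; nonnegative in every
vector when `w ≥ 0`.  For the Fejér weight it is carried by `|q_m| ≲ 2π/R`. [folklore] -/
def twistOp (w : TorusSite 2 L → ℝ) :
    Matrix (Finset (Orb (FermionTorus 2 L))) (Finset (Orb (FermionTorus 2 L))) ℂ :=
  ∑ m ∈ (Finset.univ : Finset (TorusSite 2 L)).erase 0, ((w m : ℝ) : ℂ) • modeOp L m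

/-- The Fejér weight `F̂_R(m) = R⁻⁴ |Σ_{a ∈ [0,R)²} χ_m(a)|²` — the Fourier transform of the
autocorrelation of the indicator of the box `[0,R)²`, hence `≥ 0`, with `F̂_R(0) = 1` and
`F̂_R(m) ≤ min(1, (π/(R |q_{m,i}|))²)`-type decay. [folklore] -/
def fejerWeight (R : ℕ) (m : TorusSite 2 L) : ℝ :=
  ‖∑ a : Fin 2 → Fin R, torusChar m (fun i => ((a i : ℕ) : ZMod L))‖ ^ 2 / (R : ℝ) ^ 4

/-- **FEJÉR SPLIT** (PROVED): for any weight with `w 0 = 1`,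
`localOrderOp L w − twistOp L w = L⁻⁴ Δ_dᴴ Δ_d` — the crux's order operator is local order minus
finite-momentum pair weight. [folklore] -/
theorem localOrderOp_sub_twistOp (w : TorusSite 2 L → ℝ) (hw : w 0 = 1) :
    localOrderOp L w - twistOp L w =
      ((1 : ℂ) / (L : ℂ) ^ 4) • ((pairField dWaveFormFactor L)ᴴ * pairField dWaveFormFactor L) := by
  rw [twistOp, Finset.sum_erase_eq_sub (Finset.mem_univ _),
    show (∑ m, ((fun m => ((w m : ℝ) : ℂ) • modeOp L m) m)) = localOrderOp L w from rfl, sub_sub_cancel]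
  simp only [hw, Complex.ofReal_one, one_smul, modeOp, pairFieldAt_zero]

/-- `F̂_R(0) = 1` for `R ≥ 1`. [folklore] -/
theorem fejerWeight_zero (R : ℕ) (hR : R ≠ 0) : fejerWeight L R 0 = 1 := by
  have hR' : (R : ℝ) ≠ 0 := Nat.cast_ne_zero.mpr hR
  have hsum : (∑ a : Fin 2 → Fin R, torusChar (0 : TorusSite 2 L) (fun i => ((a i : ℕ) : ZMod L))) =
      ((R : ℂ)) ^ 2 := by
    simp only [torusChar_zero_left, Finset.sum_const, Finset.card_univ, nsmul_eq_mul, mul_one,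
      Fintype.card_pi, Fintype.card_fin, Finset.prod_const]
    push_cast
    ring
  rw [fejerWeight, hsum, norm_pow, Complex.norm_natCast, ← pow_mul,
    show 2 * 2 = 4 by norm_num, div_self (pow_ne_zero 4 hR')]

end Torus

/-! ### The two stubs (Hubbard shell) and the composition into the κ-chord -/

/-- STUB 1 — **local pair-order coercivity at `(U, δ)`, scale `R`, strength `κ`, floor `a`**:
eventually in even `L`, adding the O(1)-total-strength LOCAL-ORDER penalty `κ • localOrderOp`
(Fejér weight of range `R`) raises the sector ground energy by at least `κ a`.  Physically: every
state within O(1) of the ground energy keeps d-wave pair coherence `≥ a` at scale `R` (amplitude /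
condensation sector; a twisted condensate does NOT evade it).  Engine deliverable #1; implied, by
concavity in the penalty strength, by route KacWindowPenalty's EXTENSIVE `WindowGap` with a Fejér
window. NOT a consequence of the crux's hypothesis. -/
def LocalPairCoercivityAt (U δ : ℝ) (R : ℕ) (κ a : ℝ) : Prop :=
  ∃ L₀ : ℕ, ∀ (L : ℕ) [NeZero L], L₀ ≤ L → Even L →
    let N : ℕ := 2 * ⌊(1 - δ) * (L : ℝ) ^ 2 / 2⌋₊
    let H := hubbardTorus 2 L 1 U
    let S := szSector (Λ := FermionTorus 2 L) N 0
    H.minEnergyOn S + κ * a ≤ (H + (κ : ℂ) • localOrderOp L (fejerWeight L R)).minEnergyOn S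

/-- STUB 2 — **pair stiffness against slow twists at `(U, δ)`, scale `R`, strength `κ`,
allowance `b`**: eventually in even `L`, an ATTRACTIVE finite-momentum pair term `−κ • twistOp`
(Fejér weight, momenta `|q| ≲ 2π/R`, O(1) total strength) lowers the sector ground energy by at
most `κ b`.  Physically: condensing pairs at momenta `0 < |q| ≲ 1/R` costs `≳ ρ_s (2π)²` per unit
weight (phase / Goldstone sector), up to the normal-fluctuation background `b = b(R) → 0`.  Engine
deliverable #2; it implies route KacWindowPenalty's Σ-form `WindowInfraredBound` for every ground
state.  NOT a consequence of the crux's hypothesis. -/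
def PairStiffnessAt (U δ : ℝ) (R : ℕ) (κ b : ℝ) : Prop :=
  ∃ L₀ : ℕ, ∀ (L : ℕ) [NeZero L], L₀ ≤ L → Even L →
    let N : ℕ := 2 * ⌊(1 - δ) * (L : ℝ) ^ 2 / 2⌋₊
    let H := hubbardTorus 2 L 1 U
    let S := szSector (Λ := FermionTorus 2 L) N 0
    H.minEnergyOn S - κ * b ≤ (H - (κ : ℂ) • twistOp L (fejerWeight L R)).minEnergyOn S

/-- The κ-chord at `(U, δ)` — VERBATIM the per-coupling body of the hypothesis `hchord` of the
landed closer `Theorems.birEveryGroundState_structural_of_kappaChord` (and ideator 3's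
`KappaChordAt`). -/
def KappaChordAt (U δ : ℝ) : Prop :=
  ∃ κ a : ℝ, 0 < κ ∧ 0 < a ∧ ∃ L₀ : ℕ, ∀ (L : ℕ) [NeZero L], L₀ ≤ L → Even L →
    let N : ℕ := 2 * ⌊(1 - δ) * (L : ℝ) ^ 2 / 2⌋₊
    let H := hubbardTorus 2 L 1 U
    let S := szSector (Λ := FermionTorus 2 L) N 0
    let Yd : Matrix (Finset (Orb (FermionTorus 2 L))) (Finset (Orb (FermionTorus 2 L))) ℂ :=
      ((1 : ℂ) / (L : ℂ) ^ 4) • ((pairField dWaveFormFactor L)ᴴ * pairField dWaveFormFactor L)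
    κ * a ≤ (H + (κ : ℂ) • Yd).minEnergyOn S - H.minEnergyOn S

/-- **Composition** (PROVED): local coercivity with floor `a` and stiffness with allowance
`b < a`, at the same `(U, δ, R)`, give the κ-chord with `κ = κ₁κ₂/(κ₁+κ₂)` and `a − b > 0`. -/
theorem kappaChordAt_of_local_of_stiffness (U δ : ℝ) {R : ℕ} (hR : R ≠ 0) {κ₁ κ₂ a b : ℝ}
    (hκ₁ : 0 < κ₁) (hκ₂ : 0 < κ₂) (hab : b < a)
    (hloc : LocalPairCoercivityAt U δ R κ₁ a) (hstiff : PairStiffnessAt U δ R κ₂ b) :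
    KappaChordAt U δ := by
  obtain ⟨L₁, h1⟩ := hloc
  obtain ⟨L₂, h2⟩ := hstiff
  refine ⟨κ₁ * κ₂ / (κ₁ + κ₂), a - b, by positivity, by linarith, max L₁ L₂,
    fun L _ hL hLe => ?_⟩
  have h1L := h1 L ((le_max_left _ _).trans hL) hLe
  have h2L := h2 L ((le_max_right _ _).trans hL) hLe
  simp only at h1L h2L ⊢
  have key := chord_of_local_of_stiffness (hubbardTorus 2 L 1 U) (localOrderOp L (fejerWeight L R))
    (twistOp L (fejerWeight L R))
    (szSector (Λ := FermionTorus 2 L) (2 * ⌊(1 - δ) * (L : ℝ) ^ 2 / 2⌋₊) 0) hκ₁ hκ₂ h1L h2L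
  rw [localOrderOp_sub_twistOp L (fejerWeight L R) (fejerWeight_zero L R hR)] at key
  linarith

/-- The line inside the crux, for the record (NOT claimed provable from the crux's hypothesis):
`∀ data, Hyp → ∃ U ∈ window, ∃ R κ₁ κ₂ a b, … ∧ LocalPairCoercivityAt ∧ PairStiffnessAt` would feed
`kappaChordAt_of_local_of_stiffness` and then the landed closer; the two stubs are engine
deliverables (route re-cut R-κ), see the card. -/
def LineShape : Prop :=
  ∀ (δ U₁ U₂ : ℝ), δ ∈ Set.Ioo (0:ℝ) (1/2) → 0 < U₁ → U₁ < U₂ →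
    ∃ U ∈ Set.Ioo U₁ U₂, ∃ (R : ℕ) (κ₁ κ₂ a b : ℝ), R ≠ 0 ∧ 0 < κ₁ ∧ 0 < κ₂ ∧ b < a ∧
      LocalPairCoercivityAt U δ R κ₁ a ∧ PairStiffnessAt U δ R κ₂ b

theorem kappaChord_of_lineShape (h : LineShape) :
    ∀ (δ U₁ U₂ : ℝ), δ ∈ Set.Ioo (0:ℝ) (1/2) → 0 < U₁ → U₁ < U₂ →
      ∃ U ∈ Set.Ioo U₁ U₂, KappaChordAt U δ := by
  intro δ U₁ U₂ hδ hU₁ hU₁₂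
  obtain ⟨U, hU, R, κ₁, κ₂, a, b, hR, hκ₁, hκ₂, hab, hloc, hstiff⟩ := h δ U₁ U₂ hδ hU₁ hU₁₂
  exact ⟨U, hU, kappaChordAt_of_local_of_stiffness U δ hR hκ₁ hκ₂ hab hloc hstiff⟩

end Summit.HubbardSuperconductivity.HubbardSuperconductivity.Cruxes.BirEveryGroundState.SketchIdeator4
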